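import Summits.Schanuel.Schanuel.Theorems.ZilberEacNearResonantDefs
import Mathlib.Analysis.SpecialFunctions.Complex.LogBounds
import Mathlib.Analysis.SpecialFunctions.Trigonometric.Basic
import Mathlib.Topology.Order.IntermediateValue
import HarnessLib

/-!
# The near-resonant regime: the limit equation `G̃(σ) = -2πiε` and its admissible roots

Zilber's Exponential-Algebraic Closedness, case ladder (host summit Schanuel, cell `pub-schanuel`,
seat 2, gen 13).  In the rescaled limit `d → ∞` of the critical-size system (see
`ZilberEacNearResonantDefs`) the unknown `σ = e^{-τ} = lim d / y₂` is tied to the near-resonance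
defect `ε = r₀d + n₁` by `G̃(σ) = -2πiε`, `G̃ = nrG r₀`.  Since `ε` is REAL (labels are lattice
points), the admissible limit values are the `σ ≠ 0` with `Re G̃(σ) = 0`.  This file proves:

* `norm_nrG_sub_sq_le` — the Taylor estimate `‖G̃(σ) - 2π²r₀(1-r₀)σ²‖ ≤ C‖σ‖³` on a small ball
  (the linear term `r₀·2πi(1-r₀) + (1-r₀)·(-2πir₀)` CANCELS — the criticality);
* `exists_re_nrG_eq_zero` — on every small circle `‖σ‖ = ρ` there is `σ` with `Re G̃(σ) = 0`
  (intermediate value theorem between `σ = ρ`, where `Re G̃ ≈ cρ²`, and `σ = iρ`, where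
  `Re G̃ ≈ -cρ²`; `c = 2π²r₀(1-r₀) ≠ 0` for `r₀ ∉ {0, 1}`);
* `exists_admissible_seq` — hence INFINITELY MANY admissible `σ` (pairwise distinct norms);
* `nrF_basePoint` — each admissible `σ` gives a solution `(Log(1+A₀σ), Log(1+A₁σ), -Log σ)` of the
  rescaled system at the REAL parameter `ε* = -Im G̃(σ)/(2π)`, `s = ℓ = 0`.

HONEST FRAMING: lemmas for an existence theorem about explicit members of an OPEN cell
(`ECCell 3 2`); NOT Schanuel's conjecture; EAC ⇏ SC.
-/

noncomputable section

open Complex Filter Topology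

set_option linter.dupNamespace false

namespace Summit.Schanuel.Schanuel.Theorems

section Limit

variable (r₀ : ℝ)

/-- **Taylor estimate for the limit function.**  For `‖σ‖ ≤ ρ₀ = 1/(4π(|1-r₀| + |r₀| + 1))`:
`‖G̃(σ) - 2π²r₀(1-r₀)σ²‖ ≤ C‖σ‖³` with `C = |r₀|(2π|1-r₀|)³ + |1-r₀|(2π|r₀|)³`; the linear terms
cancel. [folklore] -/
theorem norm_nrG_sub_sq_le {σ : ℂ}
    (hσ : ‖σ‖ ≤ 1 / (4 * Real.pi * (|1 - r₀| + |r₀| + 1))) :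
    ‖nrG r₀ σ - (2 * Real.pi ^ 2 * r₀ * (1 - r₀) : ℝ) * σ ^ 2‖ ≤
      (|r₀| * (2 * Real.pi * |1 - r₀|) ^ 3 + |1 - r₀| * (2 * Real.pi * |r₀|) ^ 3) * ‖σ‖ ^ 3 := by
  have hπ := Real.pi_pos
  -- `‖log(1+z) - (z - z²/2)‖ ≤ ‖z‖³` for `‖z‖ ≤ 1/2` (Mathlib's `norm_log_sub_logTaylor_le`)
  have hT : ∀ {z : ℂ}, ‖z‖ ≤ 1 / 2 → ‖log (1 + z) - (z - z ^ 2 / 2)‖ ≤ ‖z‖ ^ 3 := by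
    intro z hz
    have hz1 : ‖z‖ < 1 := by linarith
    have h := Complex.norm_log_sub_logTaylor_le 2 hz1
    have ht : logTaylor 3 z = z - z ^ 2 / 2 := by
      simp [logTaylor, Finset.sum_range_succ]
      ring
    rw [ht] at h
    refine h.trans ?_
    have h3 : (0 : ℝ) ≤ ‖z‖ ^ 3 := by positivity
    have hinv : (1 - ‖z‖)⁻¹ ≤ 2 := by
      rw [inv_le_comm₀ (by linarith) (by norm_num)]
      linarith
    calc ‖z‖ ^ (2 + 1) * (1 - ‖z‖)⁻¹ / (2 + 1) ≤ ‖z‖ ^ 3 * 2 / 3 := by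
          norm_num
          exact div_le_div_of_nonneg_right (mul_le_mul_of_nonneg_left hinv h3) (by norm_num)
      _ ≤ ‖z‖ ^ 3 := by nlinarith
  set z₀ : ℂ := 2 * Real.pi * I * ((1 - r₀ : ℝ) : ℂ) * σ with hz₀
  set z₁ : ℂ := -(2 * Real.pi * I * (r₀ : ℂ) * σ) with hz₁
  have hden : 0 < 4 * Real.pi * (|1 - r₀| + |r₀| + 1) := by positivity
  have hσρ : ‖σ‖ * (4 * Real.pi * (|1 - r₀| + |r₀| + 1)) ≤ 1 := by
    rwa [le_div_iff₀ hden] at hσ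
  have hnz₀ : ‖z₀‖ = 2 * Real.pi * |1 - r₀| * ‖σ‖ := by
    rw [hz₀]
    simp only [norm_mul, Complex.norm_ofNat, Complex.norm_real, Real.norm_eq_abs,
      abs_of_pos hπ, Complex.norm_I, mul_one]
  have hnz₁ : ‖z₁‖ = 2 * Real.pi * |r₀| * ‖σ‖ := by
    rw [hz₁, norm_neg]
    simp only [norm_mul, Complex.norm_ofNat, Complex.norm_real, Real.norm_eq_abs,
      abs_of_pos hπ, Complex.norm_I, mul_one]
  have hz₀le : ‖z₀‖ ≤ 1 / 2 := by
    rw [hnz₀]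
    have h' : ‖σ‖ * (4 * Real.pi * (|1 - r₀| + |r₀| + 1)) / 2 - 2 * Real.pi * |1 - r₀| * ‖σ‖ =
        2 * Real.pi * ‖σ‖ * (|r₀| + 1) := by ring
    have h'' : 0 ≤ 2 * Real.pi * ‖σ‖ * (|r₀| + 1) := by positivity
    linarith
  have hz₁le : ‖z₁‖ ≤ 1 / 2 := by
    rw [hnz₁]
    have h' : ‖σ‖ * (4 * Real.pi * (|1 - r₀| + |r₀| + 1)) / 2 - 2 * Real.pi * |r₀| * ‖σ‖ =
        2 * Real.pi * ‖σ‖ * (|1 - r₀| + 1) := by ring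
    have h'' : 0 ≤ 2 * Real.pi * ‖σ‖ * (|1 - r₀| + 1) := by positivity
    linarith
  have e0 := hT hz₀le
  have e1 := hT hz₁le
  -- the algebraic identity: linear terms cancel, quadratic terms give `c σ²`
  have hid : nrG r₀ σ - (2 * Real.pi ^ 2 * r₀ * (1 - r₀) : ℝ) * σ ^ 2 =
      (r₀ : ℂ) * (log (1 + z₀) - (z₀ - z₀ ^ 2 / 2)) +
        ((1 - r₀ : ℝ) : ℂ) * (log (1 + z₁) - (z₁ - z₁ ^ 2 / 2)) := by
    have e : (1 : ℂ) - 2 * Real.pi * I * (r₀ : ℂ) * σ = 1 + z₁ := by rw [hz₁]; ring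
    rw [nrG, e, hz₀, hz₁]
    push_cast
    have hI : I ^ 2 = -1 := Complex.I_sq
    linear_combination (-(2 : ℂ) * Real.pi ^ 2 * σ ^ 2 * r₀ * (1 - r₀)) * hI
  rw [hid]
  calc ‖(r₀ : ℂ) * (log (1 + z₀) - (z₀ - z₀ ^ 2 / 2)) +
        ((1 - r₀ : ℝ) : ℂ) * (log (1 + z₁) - (z₁ - z₁ ^ 2 / 2))‖
      ≤ ‖(r₀ : ℂ) * (log (1 + z₀) - (z₀ - z₀ ^ 2 / 2))‖ +
        ‖((1 - r₀ : ℝ) : ℂ) * (log (1 + z₁) - (z₁ - z₁ ^ 2 / 2))‖ := norm_add_le _ _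
    _ = |r₀| * ‖log (1 + z₀) - (z₀ - z₀ ^ 2 / 2)‖ +
        |1 - r₀| * ‖log (1 + z₁) - (z₁ - z₁ ^ 2 / 2)‖ := by
        rw [norm_mul, norm_mul, Complex.norm_real, Complex.norm_real, Real.norm_eq_abs,
          Real.norm_eq_abs]
    _ ≤ |r₀| * ‖z₀‖ ^ 3 + |1 - r₀| * ‖z₁‖ ^ 3 := by gcongr
    _ = (|r₀| * (2 * Real.pi * |1 - r₀|) ^ 3 + |1 - r₀| * (2 * Real.pi * |r₀|) ^ 3) * ‖σ‖ ^ 3 := by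
        rw [hnz₀, hnz₁]; ring

/-- `G̃` is continuous at every `σ` of the small ball (the arguments of both logarithms lie in
the slit plane). [folklore] -/
theorem continuousAt_nrG {σ : ℂ} (hσ : ‖σ‖ ≤ 1 / (4 * Real.pi * (|1 - r₀| + |r₀| + 1))) :
    ContinuousAt (nrG r₀) σ := by
  have hπ := Real.pi_pos
  have hden : 0 < 4 * Real.pi * (|1 - r₀| + |r₀| + 1) := by positivity
  have hσρ : ‖σ‖ * (4 * Real.pi * (|1 - r₀| + |r₀| + 1)) ≤ 1 := by
    rwa [le_div_iff₀ hden] at hσ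
  have h0 : ‖2 * Real.pi * I * ((1 - r₀ : ℝ) : ℂ) * σ‖ < 1 := by
    simp only [norm_mul, Complex.norm_ofNat, Complex.norm_real, Real.norm_eq_abs,
      abs_of_pos hπ, Complex.norm_I, mul_one]
    nlinarith [abs_nonneg (1 - r₀), abs_nonneg r₀, norm_nonneg σ]
  have h1 : ‖-(2 * Real.pi * I * (r₀ : ℂ) * σ)‖ < 1 := by
    rw [norm_neg]
    simp only [norm_mul, Complex.norm_ofNat, Complex.norm_real, Real.norm_eq_abs,
      abs_of_pos hπ, Complex.norm_I, mul_one]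
    nlinarith [abs_nonneg (1 - r₀), abs_nonneg r₀, norm_nonneg σ]
  have hs0 := Complex.mem_slitPlane_of_norm_lt_one h0
  have hs1 := Complex.mem_slitPlane_of_norm_lt_one h1
  have e : nrG r₀ = fun σ' : ℂ => (r₀ : ℂ) * log (1 + 2 * Real.pi * I * ((1 - r₀ : ℝ) : ℂ) * σ') +
      ((1 - r₀ : ℝ) : ℂ) * log (1 + -(2 * Real.pi * I * (r₀ : ℂ) * σ')) := by
    funext σ'; rw [nrG, ← sub_eq_add_neg]
  rw [e]
  have c0 : ContinuousAt (fun σ' : ℂ => log (1 + 2 * Real.pi * I * ((1 - r₀ : ℝ) : ℂ) * σ')) σ :=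
    ContinuousAt.clog (by fun_prop) hs0
  have c1 : ContinuousAt (fun σ' : ℂ => log (1 + -(2 * Real.pi * I * (r₀ : ℂ) * σ'))) σ :=
    ContinuousAt.clog (by fun_prop) hs1
  exact (continuousAt_const.mul c0).add (continuousAt_const.mul c1)

/-- **Admissible roots on small circles.**  For `r₀ ∉ {0,1}` and every small radius `ρ > 0` there is
`σ` with `‖σ‖ = ρ` and `Re G̃(σ) = 0` (IVT along the arc `θ ↦ ρe^{iθ}`, `0 ≤ θ ≤ π/2`: at `θ = 0`,
`Re G̃ ≈ cρ²`; at `θ = π/2`, `Re G̃ ≈ -cρ²`; `c = 2π²r₀(1-r₀) ≠ 0`). [folklore] -/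
theorem exists_re_nrG_eq_zero (h0 : r₀ ≠ 0) (h1 : r₀ ≠ 1) {ρ : ℝ} (hρ : 0 < ρ)
    (hρ₀ : ρ ≤ 1 / (4 * Real.pi * (|1 - r₀| + |r₀| + 1)))
    (hρC : (|r₀| * (2 * Real.pi * |1 - r₀|) ^ 3 + |1 - r₀| * (2 * Real.pi * |r₀|) ^ 3) * ρ ≤
      |2 * Real.pi ^ 2 * r₀ * (1 - r₀)| / 2) :
    ∃ σ : ℂ, ‖σ‖ = ρ ∧ (nrG r₀ σ).re = 0 := by
  have hπ := Real.pi_pos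
  set c : ℝ := 2 * Real.pi ^ 2 * r₀ * (1 - r₀) with hc
  set C : ℝ := |r₀| * (2 * Real.pi * |1 - r₀|) ^ 3 + |1 - r₀| * (2 * Real.pi * |r₀|) ^ 3 with hC
  have hc0 : c ≠ 0 := by
    rw [hc]
    exact mul_ne_zero (mul_ne_zero (by positivity) h0) (sub_ne_zero.2 (Ne.symm h1))
  -- the arc and the real part of `G̃` along it
  set γ : ℝ → ℂ := fun θ => (ρ : ℂ) * exp ((θ : ℂ) * I) with hγ
  have hγnorm : ∀ θ : ℝ, ‖γ θ‖ = ρ := by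
    intro θ
    rw [hγ]
    simp only [norm_mul, Complex.norm_real, Real.norm_eq_abs, abs_of_pos hρ,
      Complex.norm_exp_ofReal_mul_I, mul_one]
  set f : ℝ → ℝ := fun θ => (nrG r₀ (γ θ)).re with hf
  have hfcont : ContinuousOn f (Set.Icc 0 (Real.pi / 2)) := by
    refine Continuous.continuousOn ?_
    rw [hf]
    refine Complex.continuous_re.comp (continuous_iff_continuousAt.2 fun θ => ?_)
    refine (continuousAt_nrG r₀ (by rw [hγnorm θ]; exact hρ₀)).comp ?_
    exact (continuous_const.mul (Complex.continuous_exp.comp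
      (Complex.continuous_ofReal.mul continuous_const))).continuousAt
  -- the endpoint values
  have hγ0 : γ 0 = (ρ : ℂ) := by rw [hγ]; simp
  have hγ1 : γ (Real.pi / 2) = (ρ : ℂ) * I := by
    rw [hγ]
    simp only
    rw [show ((Real.pi / 2 : ℝ) : ℂ) * I = (Real.pi / 2 : ℝ) * I by rfl, Complex.exp_mul_I]
    push_cast
    rw [Complex.cos_pi_div_two, Complex.sin_pi_div_two]
    ring
  have hT0 := norm_nrG_sub_sq_le r₀ (σ := (ρ : ℂ)) (by
    rw [Complex.norm_real, Real.norm_eq_abs, abs_of_pos hρ]; exact hρ₀)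
  have hT1 := norm_nrG_sub_sq_le r₀ (σ := (ρ : ℂ) * I) (by
    rw [norm_mul, Complex.norm_I, mul_one, Complex.norm_real, Real.norm_eq_abs, abs_of_pos hρ]
    exact hρ₀)
  have hnρ : ‖(ρ : ℂ)‖ = ρ := by rw [Complex.norm_real, Real.norm_eq_abs, abs_of_pos hρ]
  have hnρI : ‖(ρ : ℂ) * I‖ = ρ := by rw [norm_mul, Complex.norm_I, mul_one, hnρ]
  rw [hnρ] at hT0
  rw [hnρI] at hT1
  have hCρ3 : C * ρ ^ 3 ≤ |c| / 2 * ρ ^ 2 := by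
    have := mul_le_mul_of_nonneg_right hρC (sq_nonneg ρ)
    calc C * ρ ^ 3 = C * ρ * ρ ^ 2 := by ring
      _ ≤ |c| / 2 * ρ ^ 2 := this
  -- `f 0 = cρ² + O(ρ³)`, `f (π/2) = -cρ² + O(ρ³)`
  have hf0 : |f 0 - c * ρ ^ 2| ≤ |c| / 2 * ρ ^ 2 := by
    have e : f 0 - c * ρ ^ 2 = (nrG r₀ (ρ : ℂ) - (c : ℂ) * (ρ : ℂ) ^ 2).re := by
      rw [hf]; simp only [hγ0, Complex.sub_re]
      congr 1
      rw [show (c : ℂ) * (ρ : ℂ) ^ 2 = ((c * ρ ^ 2 : ℝ) : ℂ) by push_cast; ring, Complex.ofReal_re]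
    rw [e]
    exact (Complex.abs_re_le_norm _).trans (hT0.trans hCρ3)
  have hf1 : |f (Real.pi / 2) + c * ρ ^ 2| ≤ |c| / 2 * ρ ^ 2 := by
    have e : f (Real.pi / 2) + c * ρ ^ 2 = (nrG r₀ ((ρ : ℂ) * I) - (c : ℂ) * ((ρ : ℂ) * I) ^ 2).re := by
      rw [hf]; simp only [hγ1, Complex.sub_re]
      rw [show (c : ℂ) * ((ρ : ℂ) * I) ^ 2 = ((-(c * ρ ^ 2) : ℝ) : ℂ) by
        push_cast; linear_combination (c : ℂ) * (ρ : ℂ) ^ 2 * Complex.I_sq, Complex.ofReal_re]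
      ring
    rw [e]
    exact (Complex.abs_re_le_norm _).trans (hT1.trans hCρ3)
  have hρ2 : 0 < ρ ^ 2 := by positivity
  -- intermediate value theorem, according to the sign of `c`
  have hIVT : ∃ θ ∈ Set.Icc 0 (Real.pi / 2), f θ = 0 := by
    rcases lt_or_gt_of_ne hc0 with hcneg | hcpos
    · have hca : |c| = -c := abs_of_neg hcneg
      have hA : f 0 < 0 := by
        have := (abs_le.1 hf0).2; rw [hca] at this; nlinarith
      have hB : 0 < f (Real.pi / 2) := by
        have := (abs_le.1 hf1).1; rw [hca] at this; nlinarith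
      exact intermediate_value_Icc (by positivity) hfcont ⟨hA.le, hB.le⟩
    · have hca : |c| = c := abs_of_pos hcpos
      have hA : 0 < f 0 := by
        have := (abs_le.1 hf0).1; rw [hca] at this; nlinarith
      have hB : f (Real.pi / 2) < 0 := by
        have := (abs_le.1 hf1).2; rw [hca] at this; nlinarith
      exact intermediate_value_Icc' (by positivity) hfcont ⟨hB.le, hA.le⟩
  obtain ⟨θ, -, hθ⟩ := hIVT
  exact ⟨γ θ, hγnorm θ, hθ⟩

/-- **Infinitely many admissible limit values.**  For `r₀ ∉ {0, 1}` there is an injective sequence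
`σ_k ≠ 0` with `‖2πi(1-r₀)σ_k‖ ≤ 1/2`, `‖2πir₀σ_k‖ ≤ 1/2` and `Re G̃(σ_k) = 0`. (new) -/
theorem exists_admissible_seq (h0 : r₀ ≠ 0) (h1 : r₀ ≠ 1) :
    ∃ σ : ℕ → ℂ, Function.Injective σ ∧ ∀ k, σ k ≠ 0 ∧
      ‖2 * Real.pi * I * ((1 - r₀ : ℝ) : ℂ) * σ k‖ ≤ 1 / 2 ∧
      ‖2 * Real.pi * I * (r₀ : ℂ) * σ k‖ ≤ 1 / 2 ∧ (nrG r₀ (σ k)).re = 0 := by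
  have hπ := Real.pi_pos
  set ρ₀ : ℝ := 1 / (4 * Real.pi * (|1 - r₀| + |r₀| + 1)) with hρ₀
  set c : ℝ := 2 * Real.pi ^ 2 * r₀ * (1 - r₀) with hc
  set C : ℝ := |r₀| * (2 * Real.pi * |1 - r₀|) ^ 3 + |1 - r₀| * (2 * Real.pi * |r₀|) ^ 3 with hC
  have hC0 : 0 ≤ C := by positivity
  have hc0 : c ≠ 0 := by
    rw [hc]
    exact mul_ne_zero (mul_ne_zero (by positivity) h0) (sub_ne_zero.2 (Ne.symm h1))
  have hca : 0 < |c| := abs_pos.2 hc0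
  set ρ₁ : ℝ := min ρ₀ (|c| / (2 * C + 2)) with hρ₁
  have hρ₀pos : 0 < ρ₀ := by positivity
  have hρ₁pos : 0 < ρ₁ := lt_min hρ₀pos (by positivity)
  set ρ : ℕ → ℝ := fun k => ρ₁ / ((k : ℝ) + 1) with hρ
  have hρpos : ∀ k, 0 < ρ k := fun k => by positivity
  have hρle : ∀ k, ρ k ≤ ρ₁ := fun k => by
    rw [hρ]
    exact div_le_self hρ₁pos.le (by linarith [(Nat.cast_nonneg k : (0 : ℝ) ≤ k)])
  have hadm : ∀ k, ∃ σ : ℂ, ‖σ‖ = ρ k ∧ (nrG r₀ σ).re = 0 := by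
    intro k
    refine exists_re_nrG_eq_zero r₀ h0 h1 (hρpos k) ((hρle k).trans (min_le_left _ _)) ?_
    have h2 : ρ k ≤ |c| / (2 * C + 2) := (hρle k).trans (min_le_right _ _)
    calc C * ρ k ≤ C * (|c| / (2 * C + 2)) := by gcongr
      _ ≤ |c| / 2 := by
        rw [mul_div_assoc', div_le_div_iff₀ (by positivity) (by positivity)]
        nlinarith
  choose σ hσnorm hσre using hadm
  have hρinj : Function.Injective ρ := by
    intro k k' h
    simp only [hρ] at h
    rw [div_eq_div_iff (by positivity) (by positivity)] at h
    have h' : ((k : ℝ) + 1) = (k' : ℝ) + 1 := by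
      have := mul_left_cancel₀ hρ₁pos.ne' h
      linarith
    exact_mod_cast (by linarith : (k : ℝ) = k')
  refine ⟨σ, fun k k' h => hρinj (by rw [← hσnorm k, ← hσnorm k', h]), fun k => ⟨?_, ?_, ?_, hσre k⟩⟩
  · intro h
    have := hσnorm k
    rw [h, norm_zero] at this
    exact (hρpos k).ne this
  · have hk : ‖σ k‖ ≤ ρ₀ := by rw [hσnorm k]; exact (hρle k).trans (min_le_left _ _)
    simp only [norm_mul, Complex.norm_ofNat, Complex.norm_real, Real.norm_eq_abs,
      abs_of_pos hπ, Complex.norm_I, mul_one]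
    have hden : 0 < 4 * Real.pi * (|1 - r₀| + |r₀| + 1) := by positivity
    have hσρ : ‖σ k‖ * (4 * Real.pi * (|1 - r₀| + |r₀| + 1)) ≤ 1 := by
      rwa [hρ₀, le_div_iff₀ hden] at hk
    nlinarith [abs_nonneg (1 - r₀), abs_nonneg r₀, norm_nonneg (σ k)]
  · have hk : ‖σ k‖ ≤ ρ₀ := by rw [hσnorm k]; exact (hρle k).trans (min_le_left _ _)
    simp only [norm_mul, Complex.norm_ofNat, Complex.norm_real, Real.norm_eq_abs,
      abs_of_pos hπ, Complex.norm_I, mul_one]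
    have hden : 0 < 4 * Real.pi * (|1 - r₀| + |r₀| + 1) := by positivity
    have hσρ : ‖σ k‖ * (4 * Real.pi * (|1 - r₀| + |r₀| + 1)) ≤ 1 := by
      rwa [hρ₀, le_div_iff₀ hden] at hk
    nlinarith [abs_nonneg (1 - r₀), abs_nonneg r₀, norm_nonneg (σ k)]

/-- **Base points of the rescaled system from admissible `σ`.**  For `σ ≠ 0` with
`‖A₀σ‖, ‖A₁σ‖ ≤ 1/2` (`A₀ = 2πi(1-r₀)`, `A₁ = -2πir₀`) and `Re G̃(σ) = 0`, the point
`q = (Log(1 + A₀σ), Log(1 + A₁σ), -Log σ)` solves `nrF` at the REAL parameter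
`ε* = -Im G̃(σ)/(2π)` with `s = ℓ = 0`, and `e^{q₀} = 1 + A₀σ`, `e^{q₁} = 1 + A₁σ`, `e^{-q₂} = σ`.
(new) -/
theorem nrF_basePoint {σ : ℂ} (hσ : σ ≠ 0)
    (hA₀ : ‖2 * Real.pi * I * ((1 - r₀ : ℝ) : ℂ) * σ‖ ≤ 1 / 2)
    (hA₁ : ‖2 * Real.pi * I * (r₀ : ℂ) * σ‖ ≤ 1 / 2) (hre : (nrG r₀ σ).re = 0) :
    exp (log (1 + 2 * Real.pi * I * ((1 - r₀ : ℝ) : ℂ) * σ)) =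
        1 + 2 * Real.pi * I * ((1 - r₀ : ℝ) : ℂ) * σ ∧
      exp (log (1 + -(2 * Real.pi * I * (r₀ : ℂ)) * σ)) = 1 + -(2 * Real.pi * I * (r₀ : ℂ)) * σ ∧
      exp (-(-log σ)) = σ ∧
      nrF (r₀ : ℂ) ((1 - r₀ : ℝ) : ℂ) (2 * Real.pi * I * ((1 - r₀ : ℝ) : ℂ))
          (-(2 * Real.pi * I * (r₀ : ℂ))) (2 * Real.pi * I)
        ((((-(nrG r₀ σ).im / (2 * Real.pi) : ℝ) : ℂ), 0, 0),
          (log (1 + 2 * Real.pi * I * ((1 - r₀ : ℝ) : ℂ) * σ),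
            log (1 + -(2 * Real.pi * I * (r₀ : ℂ)) * σ), -log σ)) = 0 := by
  have hπ := Real.pi_pos
  have hne0 : (1 : ℂ) + 2 * Real.pi * I * ((1 - r₀ : ℝ) : ℂ) * σ ≠ 0 := by
    intro h
    have : ‖2 * Real.pi * I * ((1 - r₀ : ℝ) : ℂ) * σ‖ = 1 := by
      rw [show 2 * Real.pi * I * ((1 - r₀ : ℝ) : ℂ) * σ = -1 by linear_combination h]
      simp
    linarith
  have hne1 : (1 : ℂ) + -(2 * Real.pi * I * (r₀ : ℂ)) * σ ≠ 0 := by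
    intro h
    have : ‖2 * Real.pi * I * (r₀ : ℂ) * σ‖ = 1 := by
      rw [show 2 * Real.pi * I * (r₀ : ℂ) * σ = 1 by linear_combination -h]
      simp
    linarith
  have e0 := Complex.exp_log hne0
  have e1 := Complex.exp_log hne1
  have e2 : exp (-(-log σ)) = σ := by rw [neg_neg, Complex.exp_log hσ]
  refine ⟨e0, e1, e2, ?_⟩
  -- the value `G̃(σ)` is purely imaginary: `G̃(σ) = i Im G̃(σ)`
  have hG : nrG r₀ σ = (r₀ : ℂ) * log (1 + 2 * Real.pi * I * ((1 - r₀ : ℝ) : ℂ) * σ) +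
      ((1 - r₀ : ℝ) : ℂ) * log (1 + -(2 * Real.pi * I * (r₀ : ℂ)) * σ) := by
    rw [nrG]
    congr 2
    ring
  set y : ℝ := (nrG r₀ σ).im with hy
  have hGim : nrG r₀ σ = (y : ℂ) * I := by
    apply Complex.ext <;> simp [hre, hy]
  unfold nrF
  simp only [zero_mul, add_zero, e0, e1, e2, Prod.mk_eq_zero]
  refine ⟨by ring, by ring, ?_⟩
  rw [← hG, hGim]
  have hπ0 : (Real.pi : ℂ) ≠ 0 := by exact_mod_cast hπ.ne'
  push_cast
  field_simp
  ring

end Limit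

end Summit.Schanuel.Schanuel.Theorems

end
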